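import Summits.AtomisticToContinuum.Crystallization.Theorems.ChartedZeroExcessLayeredLatticeLiouvilleZZZQ

/-!
(SPLIT FOR THE 400-LINE CAP by the landing lane, hand-2 g41: this file = part 1 of 2; sequels `…ChartedZeroExcessLayeredLatticeLiouvilleZZZR` import it in a chain; same namespace, all FQNs unchanged.)
# ChartedZeroExcess · LayeredLatticeLiouville ZZZR (lens-2 g85 NODE 85, part 2) — THE TUBE DICHOTOMY OF THE RESIDUAL-DECIDING LEAF (QCᴸ):
# in-tube side DISCHARGED by (XRᴸ)/(X1ᴸ); generic side = (OMᴸ) «grand minimisers lie in the label tube» ⟸ (OGᴸ) «off-tube energy gap»;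
# DOOR OF RECORD `[MCMC](ϑc) ⟸ (SC) ∧ (OMᴸ)` (two open hypotheses; (XRᴸ), (GL₂) PROVED)

Lineage `stmt-AtomisticToContinuum-26636` (route ChartedPlanarOrder), lens-2 «structural dichotomy (special vs generic)» g85; BLOCKER FIRST on the
residual-deciding leaf of the W2 line of record, (QCᴸ) `LabelSegmentCoercivityP` (tree ZZZP; critic row 1540).  Part 1 (ZZZQ) PROVED (XRᴸ).

THE DICHOTOMY (the lens applied INSIDE the leaf, on the actual core `xf`): SPECIAL = `xf` is a member of the OUTER bond tube about its own label image,
`bondTube (S ∖ core) Rg sb dI dB (lab ∘ xf)`; GENERIC = it is not.  Two observations make the cut FREE: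
* the door's glue consumes (QCᴸ) only through «the grand minimiser `xf` EQUALS the filling `y`», and a member of the outer tube is ALREADY `ϑ`-tame by
  (XRᴸ) (`IsFreeTubeReference`, PROVED in ZZZQ) — so on the special side NOTHING is needed: ★ EXCLUSION DOOR `mildCoolMoatClampedCoreP_of_minInLabelTube`:
  (SC) ∧ (GL₂) ∧ (XRᴸ) ∧ (OMᴸ) ⟹ [MCMCᶜ], where **(OMᴸ) `MinInLabelTubeP`: the enumerated grand-clamped-minimising core lies in the outer tube about its
  label image** (no filling, no energy, no door level in the statement; the WEAKEST form the door consumes);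
* in the κ-language of row 1540 the special side is first-order convexity (X1ᴸ) between the tube members `y` (critical ⇒ supporting functional `0` by
  `HasFDerivAt.unique`) and `xf` (`labelTubeCoercivityP_of_dichotomy`): the «uniform harmonic floor» is needed ONLY on the tube, where (X1ᴸ) asserts it.
The GENERIC side in energy form is ★ **(OGᴸ) `OffTubeGapP … g₀`: an off-tube admissible core costs at least `g₀` more than every inner-tube critical tame
filling** (TWO-SIDED instrumentable, «OffTubeGap-T»); PROVED: (QEᴸ⁺) ∧ (OGᴸ) ⟹ (OMᴸ) (`minInLabelTubeP_of_gap`), (QEᴸ⁺) ∧ (QCᴸ⁺) ⟹ (OMᴸ)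
(`minInLabelTubeP_of_coercivity`), (QCᴸ)(dL := dB₁) ⟹ (QCᴸ⁺) ⟹ (OGᴸ)(κ·margin²) (`labelTubeCoercivityP_of_segment`, `offTubeGapP_of_labelTubeCoercivity`),
and conversely (XRᴸ) ∧ (X1ᴸ)(lam) ∧ (OGᴸ)(g₀) ⟹ (QCᴸ⁺)(min lam (g₀/M)) with the explicit displacement-count constant `M` (label displacement `≤ 2ρ + 2q + ε`
on the core from ZZZQ's label locality; packing count `n ≤ (2(ρ + q)/(27/32) + 1)³`) — so OFF the tube «gap» and «modulus» are EQUIVALENT and nothing of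
row 1540's door is lost.  (QEᴸ⁺) `LabelTubeFillingP` (the load-path filling remembered to lie in the INNER tube) is PROVED ⟸ (XRᴸ) ∧ (X1ᴸ) ∧ (X2ᴸ)
(tree ZZZP's engine verbatim).

NET AT THE RECORD DIALS (0 sorry): `mildCoolMoatCorePG_OM_record` / `_OM_fat`: **`[MCMC](ϑc)` ⟸ (SC) ∧ (OMᴸ)** (outer radii anywhere in ZZZQ's (XRᴸ)
polytope; fattest certified tube `(Rg, sb, dI, dB) = (121/25, 249/5000, 249/5000, 21/50)`); `mildCoolMoatCorePG_W2'_record` / `_marks`: `[MCMC](ϑc)` ⟸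
(SC) ∧ (X1ᴸ) ∧ (X2ᴸ) ∧ (OGᴸ) — row 1540's door with (QCᴸ) replaced by the WEAKER (OGᴸ); the load path (X1ᴸ)/(X2ᴸ) is thereby DEMOTED from door
hypothesis to the energetic sufficient route for (OMᴸ).

TAGS.  (QEᴸ⁺) PROVED.  (OMᴸ): GEOMETRIC-RIGIDITY-type («local minimality + crystalline collar + a-priori ϑp-tameness ⇒ bond-coherence with the
crystal») · NEW · UNDECIDED · TRUE-type-expected · ⟸ (QCᴸ) (PROVED chain) · NOT weaker than the target (conclusion bond-scale `sb` and core-wide; the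
target concludes `tameRadius`-tameness on `K`) · ONE-SIDED instrumentable · BET · ATTACKABLE-L only through (OGᴸ) or an (untyped) inward-propagation
a-priori estimate.  (OGᴸ): ENERGETIC · `κ`-FREE · NON-PERTURBATIVE · NEW · UNDECIDED · TRUE-type-expected · WEAKER than (QCᴸ⁺) (PROVED) · TWO-SIDED
INSTRUMENTABLE «OffTubeGap-T» (constrained relaxation of the synthetic clean tame cores of LabelSegmentBorn-T — twisted, bent, rolled, uniformly strained,
rattlers — glued into the registered collar under «stay off the outer tube about the label image»; report `min [E(xf) − E(y)]`; PASS iff `> 0`, any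
positive value is a valid `g₀`; KILL iff some off-tube clean tame core has `E(xf) ≤ E(y)`) · ATTACKABLE-L by discrete geometric rigidity
(Friesecke–James–Müller 2002; Schmidt 2009; Theil 2006) + a LOCAL ENERGY-WELL certificate on the `ϑp`-tame star range (CERT, computer-assisted;
BARRIER-adjacent: tetrahedral frustration — icosahedral stars beat cuboctahedral ones and must be excluded by `ϑp = 1/10`) + clamped Korn–Poincaré on the
core ball (E–Ming 2007 / Ortner–Theil 2013 for the local uniqueness of the atomistic boundary-value problem).
Why (OGᴸ)/(OMᴸ) might fail: a clean `ϑp`-tame METASTABLE bond-incoherent core (elastically accommodated micro-rotation or `≈ 5 %` strain pocket, or — at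
much larger `ρ` only — an hcp/fcc restacking bounded by a partial loop, the LJ hcp–fcc degeneracy) with energy at or below the crystalline filling.
Sources: tree ZZZP/ZZZQ/YM/YN (g67 «TubeCut» is the nearest prior move: it cut by sitewise distance to the unknown filling and paid the near side with a new
CERT piece (QU) ⟸ (QH)(rb); here the cut is by membership of the ACTUAL MINIMISER in the tube about the KNOWN crystal patch and the near side is paid by
the proved (XRᴸ)); Friesecke–James–Müller, Comm. Pure Appl. Math. 55 (2002) 1461; B. Schmidt, Multiscale Model. Simul. 8 (2009); F. Theil, Comm. Math.
Phys. 262 (2006) 209; W. E–P. Ming, Arch. Ration. Mech. Anal. 183 (2007) 241; C. Ortner–F. Theil, ARMA 207 (2013) 1025; memo NODE-g85.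

0 sorry; imports = ZZZQ (this generation's part 1; tree ZZZP below it); axioms standard.
-/

noncomputable section

open scoped BigOperators Classical InnerProductSpace RealInnerProductSpace
open MeasureTheory Set Metric Filter Topology
open Literature.Geometry.DiscreteGeometry (IsTwoShellGoodSet)
open Literature.MathematicalPhysics.StatisticalMechanics (lennardJones card_le_of_separated_of_dist_le)

namespace Summit.AtomisticToContinuum.Crystallization.Theorems.ChartedZeroExcessLayeredLatticeLiouville

open Summit.AtomisticToContinuum.Crystallization.Theorems.ChartedPlanarOrderRigidityDoor (E3 IsClean)
open Summit.AtomisticToContinuum.Crystallization.Theorems.ChartedPlanarOrderDensityDichotomy (μS IsSep)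
open Summit.AtomisticToContinuum.Crystallization.Theorems.ChartedPlanarOrderCleanScaleP (IsCleanP IsDoorSetP)
open Summit.AtomisticToContinuum.Crystallization.Theorems.ChartedPlanarOrderMesoCut (LayeredHom EnvClose)
open Summit.AtomisticToContinuum.Crystallization.Theorems.ChartedPlanarOrderDoorLayeredOsc (IsTwoShellAffineGood)

/-! ### ZZZR-1  The tube-remembering pieces (QEᴸ⁺), (QCᴸ⁺); the generic piece in energy form (OGᴸ) and in exclusion form (OMᴸ) -/

section TubePieces

/-- ★★ **(QEᴸ⁺) «LabelTubeFillingP … Rg sb₁ dI₁ dB₁ …» — THE TAME CRITICAL FILLING IN THE INNER TUBE ABOUT THE LABEL IMAGE.**  Tree ZZZP's (QEᴸ)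
`LabelSlavedFillingP` with the conclusion `dist(lab (xf i), y i) ≤ dL` STRENGTHENED to full inner-tube membership `y ∈ bondTube (S ∖ core) Rg sb₁ dI₁
dB₁ (lab ∘ xf)` — which the load-path engine proves anyway (`labelTubeFillingP_of_loadPath`).  ANALYTIC · PROVED ⟸ (XRᴸ) ∧ (X1ᴸ) ∧ (X2ᴸ).
[this file, g85] -/
def LabelTubeFillingP (ϑc ϑ ϑp r rΘ q rsh ρ rm σ ϑr Rs ε rI ℓ Rg sb₁ dI₁ dB₁ aHi Λ θ s : ℝ) : Prop :=
  ∀ δ : ℝ, 0 < δ → ∀ a : ℝ, 0 < a →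
    ∀ S : Set E3, IsDoorSetP aHi δ S → (∀ z : E3, Summable fun y : S => lennardJones (dist z (y : E3))) →
      (∀ p ∈ S, IsTwoShellAffineGood θ S p) →
        ∀ (L : E3 ≃L[ℝ] E3) (w : ℤ → E3), IsEquilChart a s Λ L w →
          ∀ (x₀ : E3) (K : Set E3), K ⊆ S → (∀ k ∈ K, dist k x₀ ≤ q) →
            IsTameOn ϑp S (LayeredHom (L : E3 →L[ℝ] E3) w) (coreOf S K rm) →
              IsTameOn ϑc S (LayeredHom (L : E3 →L[ℝ] E3) w) (moatIn S K r (r + rsh)) →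
                ∀ (n : ℕ) (xf : Fin n → E3), Function.Injective xf → Set.range xf = coreOf S K ρ →
                  ∀ (L' : E3 →L[ℝ] E3) (w' : ℤ → E3) (U : E3 ≃ₗᵢ[ℝ] E3) (t : E3),
                    IsCoolShadowCrystal σ ϑr Rs ε r rI ℓ S K (LayeredHom (L : E3 →L[ℝ] E3) w) L' w' U t →
                      ∀ lab : E3 → E3, IsBondLabel ε rΘ ℓ S K (placedCrystal L' w' U t) lab →
                        ∃ y ∈ bondTube (S \ coreOf S K ρ) Rg sb₁ dI₁ dB₁ (fun i => lab (xf i)),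
                          Function.Injective y ∧ Disjoint (Set.range y) (S \ coreOf S K ρ) ∧
                            HasFDerivAt (fun z : Fin n → E3 => clampedEnergy (S \ coreOf S K ρ) z) (0 : (Fin n → E3) →L[ℝ] ℝ) y ∧
                              ∀ i, IsTameStar ϑ ((S \ coreOf S K ρ) ∪ Set.range y) (LayeredHom (L : E3 →L[ℝ] E3) w) (y i)

/-- ★★★ **(QCᴸ⁺) «LabelTubeCoercivityP … Rg sb₁ dI₁ dB₁ κ …» — COERCIVITY OF THE CLAMPED ENERGY AT THE ACTUAL CORE OVER INNER-TUBE CRITICAL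
FILLINGS.**  Tree ZZZP's (QCᴸ) `LabelSegmentCoercivityP` with the filling hypothesis `dist(lab (xf i), y i) ≤ dL` replaced by inner-tube membership:
for every admissible core `xf`, cool shadow crystal, bond label, and every injective, exterior-avoiding, CLAMPED-CRITICAL, `ϑ`-tame filling `y` in the
inner tube about `lab ∘ xf`: `E(y) + κ·Σ dist(xf i, y i)² ≤ E(xf)`.  WEAKER than (QCᴸ)(dL := dB₁) (fewer fillings); splits as (X1ᴸ)|tube ∧ (OGᴸ)
(`labelTubeCoercivityP_of_dichotomy`). [this file, g85] -/
def LabelTubeCoercivityP (ϑc ϑ ϑp r rΘ q rsh ρ rm σ ϑr Rs ε rI ℓ Rg sb₁ dI₁ dB₁ κ aHi Λ θ s : ℝ) : Prop :=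
  ∀ δ : ℝ, 0 < δ → ∀ a : ℝ, 0 < a →
    ∀ S : Set E3, IsDoorSetP aHi δ S → (∀ z : E3, Summable fun y : S => lennardJones (dist z (y : E3))) →
      (∀ p ∈ S, IsTwoShellAffineGood θ S p) →
        ∀ (L : E3 ≃L[ℝ] E3) (w : ℤ → E3), IsEquilChart a s Λ L w →
          ∀ (x₀ : E3) (K : Set E3), K ⊆ S → (∀ k ∈ K, dist k x₀ ≤ q) →
            IsTameOn ϑp S (LayeredHom (L : E3 →L[ℝ] E3) w) (coreOf S K rm) →
              IsTameOn ϑc S (LayeredHom (L : E3 →L[ℝ] E3) w) (moatIn S K r (r + rsh)) →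
                ∀ (n : ℕ) (xf : Fin n → E3), Function.Injective xf → Set.range xf = coreOf S K ρ →
                  ∀ (L' : E3 →L[ℝ] E3) (w' : ℤ → E3) (U : E3 ≃ₗᵢ[ℝ] E3) (t : E3),
                    IsCoolShadowCrystal σ ϑr Rs ε r rI ℓ S K (LayeredHom (L : E3 →L[ℝ] E3) w) L' w' U t →
                      ∀ lab : E3 → E3, IsBondLabel ε rΘ ℓ S K (placedCrystal L' w' U t) lab →
                        ∀ y ∈ bondTube (S \ coreOf S K ρ) Rg sb₁ dI₁ dB₁ (fun i => lab (xf i)),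
                          Function.Injective y → Disjoint (Set.range y) (S \ coreOf S K ρ) →
                            HasFDerivAt (fun z : Fin n → E3 => clampedEnergy (S \ coreOf S K ρ) z) (0 : (Fin n → E3) →L[ℝ] ℝ) y →
                              (∀ i, IsTameStar ϑ ((S \ coreOf S K ρ) ∪ Set.range y) (LayeredHom (L : E3 →L[ℝ] E3) w) (y i)) →
                                clampedEnergy (S \ coreOf S K ρ) y + κ * ∑ i, dist (xf i) (y i) ^ 2 ≤
                                  clampedEnergy (S \ coreOf S K ρ) xf

/-- ★★★ **(OGᴸ) «OffTubeGapP … Rg sb dI dB sb₁ dI₁ dB₁ g₀ …» — THE OFF-TUBE ENERGY GAP (the GENERIC side of the tube dichotomy).**  Under the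
binders of (QCᴸ⁺): if the actual core `xf` is NOT a member of the outer bond tube `bondTube (S ∖ core) Rg sb dI dB (lab ∘ xf)` about its own label image
— some `Rg`-pair of core atoms deviates from the crystal bond by `> sb`, or some collar-near site by `> dI`, or some site by `> dB` — then for every
injective, exterior-avoiding, clamped-critical, `ϑ`-tame filling `y` in the inner tube: `E(y) + g₀ ≤ E(xf)`.  A PLAIN ENERGY GAP (no modulus, no
pairing in the conclusion).  ENERGETIC · NON-PERTURBATIVE · UNDECIDED · TRUE-type-expected · WEAKER than (QCᴸ⁺) (`offTubeGapP_of_labelTubeCoercivity`)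
· INSTRUMENTABLE (OffTubeGap-T) · ATTACKABLE-L (discrete geometric rigidity + local energy well + clamped Korn–Poincaré; see the module docstring).
Why it might fail: a clean tame metastable off-tube core below the crystalline filling (module docstring).  Sources: module docstring. [this file, g85] -/
def OffTubeGapP (ϑc ϑ ϑp r rΘ q rsh ρ rm σ ϑr Rs ε rI ℓ Rg sb dI dB sb₁ dI₁ dB₁ g₀ aHi Λ θ s : ℝ) : Prop :=
  ∀ δ : ℝ, 0 < δ → ∀ a : ℝ, 0 < a →
    ∀ S : Set E3, IsDoorSetP aHi δ S → (∀ z : E3, Summable fun y : S => lennardJones (dist z (y : E3))) →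
      (∀ p ∈ S, IsTwoShellAffineGood θ S p) →
        ∀ (L : E3 ≃L[ℝ] E3) (w : ℤ → E3), IsEquilChart a s Λ L w →
          ∀ (x₀ : E3) (K : Set E3), K ⊆ S → (∀ k ∈ K, dist k x₀ ≤ q) →
            IsTameOn ϑp S (LayeredHom (L : E3 →L[ℝ] E3) w) (coreOf S K rm) →
              IsTameOn ϑc S (LayeredHom (L : E3 →L[ℝ] E3) w) (moatIn S K r (r + rsh)) →
                ∀ (n : ℕ) (xf : Fin n → E3), Function.Injective xf → Set.range xf = coreOf S K ρ →
                  ∀ (L' : E3 →L[ℝ] E3) (w' : ℤ → E3) (U : E3 ≃ₗᵢ[ℝ] E3) (t : E3),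
                    IsCoolShadowCrystal σ ϑr Rs ε r rI ℓ S K (LayeredHom (L : E3 →L[ℝ] E3) w) L' w' U t →
                      ∀ lab : E3 → E3, IsBondLabel ε rΘ ℓ S K (placedCrystal L' w' U t) lab →
                        xf ∉ bondTube (S \ coreOf S K ρ) Rg sb dI dB (fun i => lab (xf i)) →
                          ∀ y ∈ bondTube (S \ coreOf S K ρ) Rg sb₁ dI₁ dB₁ (fun i => lab (xf i)),
                            Function.Injective y → Disjoint (Set.range y) (S \ coreOf S K ρ) →
                              HasFDerivAt (fun z : Fin n → E3 => clampedEnergy (S \ coreOf S K ρ) z) (0 : (Fin n → E3) →L[ℝ] ℝ) y →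
                                (∀ i, IsTameStar ϑ ((S \ coreOf S K ρ) ∪ Set.range y) (LayeredHom (L : E3 →L[ℝ] E3) w) (y i)) →
                                  clampedEnergy (S \ coreOf S K ρ) y + g₀ ≤ clampedEnergy (S \ coreOf S K ρ) xf

/-- ★★★ **(OMᴸ) «MinInLabelTubeP … Rg sb dI dB …» — GRAND-CLAMPED-MINIMISING CORES LIE IN THE OUTER BOND TUBE ABOUT THEIR LABEL IMAGE (the EXCLUSION
form of the generic side; the WEAKEST form the door consumes).**  Under the door's own binders (θ-good `aHi`-door set, equilibrium chart, container
`K ⊆ S ∩ B̄(x₀, q)`, `ϑp`-mild `rm`-core, `ϑc`-cool moat, GRAND CLAMPED MINIMALITY of the `ρ`-core) and for every cool shadow crystal and bond label: the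
enumerated core `xf` is a member of `bondTube (S ∖ core) Rg sb dI dB (lab ∘ xf)`.  NO door level `ϑ`, NO filling, NO energy in the statement.  With (XRᴸ)
(tube members are `ϑ`-tame, PROVED in ZZZQ) it closes the door AT ONCE (`mildCoolMoatClampedCoreP_of_minInLabelTube`) — the load path is not needed for
the door, only for the ENERGETIC sufficient route (OGᴸ) ∧ (QEᴸ⁺) ⟹ (OMᴸ) (`minInLabelTubeP_of_gap`; also (QCᴸ⁺) ∧ (QEᴸ⁺) ⟹ (OMᴸ),
`minInLabelTubeP_of_coercivity`).  GEOMETRIC-RIGIDITY-type («minimisers with crystalline collar are bond-coherent with the crystal») · NEW · UNDECIDED ·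
TRUE-type-expected · ONE-SIDED instrumentable (a sampled off-tube core is never certified to be the grand minimiser; OffTubeGap-T refutes through (OGᴸ))
· BET; NOT weaker than the target (its conclusion is bond-scale and core-wide) but ⟸ (QCᴸ) of row 1540 (PROVED chain).  Antitone in `Rg`, monotone in
`sb, dI, dB` (bigger tube = weaker claim): state it at the FATTEST tube (XRᴸ) certifies (`sb, dI < tameRadius − 2·10⁻⁴`, `2·dB < 17/20`, `Rg ≥ 4 + 2·dB`).
Why it might fail: as (OGᴸ) (a metastable bond-incoherent tame core that is the GRAND minimiser of its exterior problem). [this file, g85] -/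
def MinInLabelTubeP (ϑc ϑp r rΘ q rsh ρ rm σ ϑr Rs ε rI ℓ Rg sb dI dB aHi Λ θ s : ℝ) : Prop :=
  ∀ δ : ℝ, 0 < δ → ∀ a : ℝ, 0 < a →
    ∀ S : Set E3, IsDoorSetP aHi δ S → (∀ z : E3, Summable fun y : S => lennardJones (dist z (y : E3))) →
      (∀ p ∈ S, IsTwoShellAffineGood θ S p) →
        ∀ (L : E3 ≃L[ℝ] E3) (w : ℤ → E3), IsEquilChart a s Λ L w →
          ∀ (x₀ : E3) (K : Set E3), K ⊆ S → (∀ k ∈ K, dist k x₀ ≤ q) →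
            IsTameOn ϑp S (LayeredHom (L : E3 →L[ℝ] E3) w) (coreOf S K rm) →
              IsTameOn ϑc S (LayeredHom (L : E3 →L[ℝ] E3) w) (moatIn S K r (r + rsh)) →
                IsGrandClampedMin S (coreOf S K ρ) →
                  ∀ (n : ℕ) (xf : Fin n → E3), Function.Injective xf → Set.range xf = coreOf S K ρ →
                    ∀ (L' : E3 →L[ℝ] E3) (w' : ℤ → E3) (U : E3 ≃ₗᵢ[ℝ] E3) (t : E3),
                      IsCoolShadowCrystal σ ϑr Rs ε r rI ℓ S K (LayeredHom (L : E3 →L[ℝ] E3) w) L' w' U t →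
                        ∀ lab : E3 → E3, IsBondLabel ε rΘ ℓ S K (placedCrystal L' w' U t) lab →
                          xf ∈ bondTube (S \ coreOf S K ρ) Rg sb dI dB (fun i => lab (xf i))

/-- (OMᴸ) is monotone in the tube radii (a bigger tube is a weaker claim). [formal bookkeeping] -/
theorem MinInLabelTubeP.mono {ϑc ϑp r rΘ q rsh ρ rm σ ϑr Rs ε rI ℓ Rg sb dI dB sb' dI' dB' aHi Λ θ s : ℝ} (hsb : sb ≤ sb') (hdI : dI ≤ dI')
    (hdB : dB ≤ dB') (h : MinInLabelTubeP ϑc ϑp r rΘ q rsh ρ rm σ ϑr Rs ε rI ℓ Rg sb dI dB aHi Λ θ s) :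
    MinInLabelTubeP ϑc ϑp r rΘ q rsh ρ rm σ ϑr Rs ε rI ℓ Rg sb' dI' dB' aHi Λ θ s :=
  fun δ hδ a ha S hS hsum hgood L w hLw x₀ K hKS hKq hmild hcool hmin n xf hxf hrange L' w' U t hC lab hlab =>
    bondTube_mono hsb hdI hdB (h δ hδ a ha S hS hsum hgood L w hLw x₀ K hKS hKq hmild hcool hmin n xf hxf hrange L' w' U t hC lab hlab)

/-- (QCᴸ)(dL := dB₁) ⟹ (QCᴸ⁺): the tube-remembering form is WEAKER. [formal bookkeeping] -/
theorem labelTubeCoercivityP_of_segment {ϑc ϑ ϑp r rΘ q rsh ρ rm σ ϑr Rs ε rI ℓ Rg sb₁ dI₁ dB₁ κ aHi Λ θ s : ℝ}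
    (h : LabelSegmentCoercivityP ϑc ϑ ϑp r rΘ q rsh ρ rm σ ϑr Rs ε rI ℓ dB₁ κ aHi Λ θ s) :
    LabelTubeCoercivityP ϑc ϑ ϑp r rΘ q rsh ρ rm σ ϑr Rs ε rI ℓ Rg sb₁ dI₁ dB₁ κ aHi Λ θ s :=
  fun δ hδ a ha S hS hsum hgood L w hLw x₀ K hKS hKq hmild hcool n xf hxf hrange L' w' U t hC lab hlab y hyT hyinj hydisj hcrit htame =>
    h δ hδ a ha S hS hsum hgood L w hLw x₀ K hKS hKq hmild hcool n xf hxf hrange L' w' U t hC lab hlab y hyinj hydisj hcrit htame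
      fun i => by rw [dist_comm]; exact hyT.2.2 i

/-- (OGᴸ) is antitone in the gap. [formal bookkeeping] -/
theorem OffTubeGapP.of_le {ϑc ϑ ϑp r rΘ q rsh ρ rm σ ϑr Rs ε rI ℓ Rg sb dI dB sb₁ dI₁ dB₁ g₀ g₀' aHi Λ θ s : ℝ} (hg : g₀' ≤ g₀)
    (h : OffTubeGapP ϑc ϑ ϑp r rΘ q rsh ρ rm σ ϑr Rs ε rI ℓ Rg sb dI dB sb₁ dI₁ dB₁ g₀ aHi Λ θ s) :
    OffTubeGapP ϑc ϑ ϑp r rΘ q rsh ρ rm σ ϑr Rs ε rI ℓ Rg sb dI dB sb₁ dI₁ dB₁ g₀' aHi Λ θ s :=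
  fun δ hδ a ha S hS hsum hgood L w hLw x₀ K hKS hKq hmild hcool n xf hxf hrange L' w' U t hC lab hlab hoff y hyT hyinj hydisj hcrit htame =>
    by linarith [h δ hδ a ha S hS hsum hgood L w hLw x₀ K hKS hKq hmild hcool n xf hxf hrange L' w' U t hC lab hlab hoff y hyT hyinj hydisj
          hcrit htame]

end TubePieces

/-! ### ZZZR-2  Two kinematic bounds: label displacement on the core, packing count of the core -/

section KinematicBounds

/-- ★ **LABEL DISPLACEMENT ON THE CORE (PROVED)**: under the hypotheses of ZZZQ `label_near_of_core`, `dist (p, lab p) ≤ 2ρ + 2q + ε` for every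
atom `p` of the `ρ`-core (its label is within `ρ + ε` of `K ⊆ B̄(x₀, q)`, itself within `ρ` of `K`). [this file, g85] -/
theorem dist_label_le_of_core {S K C : Set E3} {σC ε rΘ ℓ rI : ℝ} {lab : E3 → E3} {Ψ : ℤ × ℤ × ℤ → E3} {τS : ℤ → Bool} {x₀ : E3}
    {δ q ρ : ℝ} (hΨ : IsBarlowBondChart S Set.univ Ψ τS) (hsurjΨ : ∀ p ∈ S, ∃ x, Ψ x = p)
    (hclean : ∀ p ∈ S, IsTwoShellGoodSet (1 / 16) (9 / 10) 1 S p) (hδ : 0 < δ) (hsepS : IsSep δ S)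
    (hsepC : IsSep σC C) (hε₀ : 0 ≤ ε) (hε : 2 * ε < σC) (hcoolI : rΘ + ε < rI) (hKq : ∀ k ∈ K, dist k x₀ ≤ q)
    (hzone : rΘ + 2 * q + 2 * (28 / 25) + 2 * ε < ℓ) (hrI : rI + 28 / 25 + ε < ℓ)
    (hin : ∀ c ∈ C, (∃ k ∈ K, dist c k < ℓ) → (∀ k ∈ K, rI < dist c k) → ∃ p ∈ S, dist p c ≤ ε)
    (hlab : IsBondLabel ε rΘ ℓ S K C lab) (hρℓ : ρ < ℓ) (hrIρ : rI ≤ ρ + ε) {p : E3} (hp : p ∈ coreOf S K ρ) :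
    dist p (lab p) ≤ 2 * ρ + 2 * q + ε := by
  obtain ⟨k, hk, hd⟩ := label_near_of_core hΨ hsurjΨ hclean hδ hsepS hsepC hε₀ hε hcoolI hKq hzone hrI hin hlab hρℓ hrIρ hp
  obtain ⟨-, k', hk', hd'⟩ := hp
  linarith [dist_triangle4 p k' k (lab p), dist_triangle k' x₀ k, hKq k hk, hKq k' hk', dist_comm x₀ k, dist_comm k (lab p)]

/-- ★ **PACKING COUNT OF THE CORE (PROVED)**: an injective enumeration `xf : Fin n → E3` of the `ρ`-core of a `δ`-separated `S` with `K ⊆ B̄(x₀, q)`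
has `n ≤ (2(ρ + q)/δ + 1)³` (Literature `card_le_of_separated_of_dist_le`). [this file, g85] -/
theorem card_core_le {S K : Set E3} {x₀ : E3} {δ q ρ : ℝ} (hδ : 0 < δ) (hsepS : IsSep δ S) (hKq : ∀ k ∈ K, dist k x₀ ≤ q) (hρq : 0 ≤ ρ + q)
    {n : ℕ} {xf : Fin n → E3} (hxf : Function.Injective xf) (hrange : Set.range xf = coreOf S K ρ) :
    (n : ℝ) ≤ (2 * (ρ + q) / δ + 1) ^ 3 := by
  classical
  have hcore : ∀ i, xf i ∈ coreOf S K ρ := fun i => hrange ▸ Set.mem_range_self i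
  have h1 := card_le_of_separated_of_dist_le (Finset.univ.image xf) x₀ hδ hρq
    (fun c hc => by
      obtain ⟨i, -, rfl⟩ := Finset.mem_image.1 hc
      obtain ⟨-, k, hk, hd⟩ := hcore i
      linarith [dist_triangle (xf i) k x₀, hKq k hk])
    (fun c hc d hd hcd => by
      obtain ⟨i, -, rfl⟩ := Finset.mem_image.1 hc
      obtain ⟨j, -, rfl⟩ := Finset.mem_image.1 hd
      exact hsepS _ (hcore i).1 _ (hcore j).1 hcd)
  rw [finrank_euclideanSpace_fin, Finset.card_image_of_injective _ hxf, Finset.card_univ, Fintype.card_fin] at h1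
  simpa using h1

end KinematicBounds

/-! ### ZZZR-3  Off the tube, gap ⟺ modulus: (QCᴸ⁺) ⟸ (XRᴸ) ∧ (X1ᴸ)|tube ∧ (OGᴸ); conversely (OGᴸ) ⟸ (QCᴸ⁺) -/

section Dichotomy

/-- the displacement-count constant `M(ρ, q, ε, dB₁) = (2(ρ + q)/(27/32) + 1)³ · (2ρ + 2q + ε + dB₁)²` converting a gap into a modulus.
[this file, g85] -/
def gapModulusConst (ρ q ε dB₁ : ℝ) : ℝ := (2 * (ρ + q) / (27 / 32) + 1) ^ 3 * (2 * ρ + 2 * q + ε + dB₁) ^ 2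

/-- the constant is positive for `0 ≤ ρ + q`, `0 < 2ρ + 2q + ε + dB₁`. [formal bookkeeping] -/
theorem gapModulusConst_pos {ρ q ε dB₁ : ℝ} (hρq : 0 ≤ ρ + q) (hD : 0 < 2 * ρ + 2 * q + ε + dB₁) : 0 < gapModulusConst ρ q ε dB₁ := by
  unfold gapModulusConst
  have h1 : 0 < 2 * (ρ + q) / (27 / 32) + 1 := by positivity
  positivity

/-- ★★★ **THE TUBE DICHOTOMY (PROVED): (XRᴸ) ∧ (X1ᴸ)(lam) ∧ (OGᴸ)(g₀) ⟹ (QCᴸ⁺)(κ := min lam (g₀ / M))** (`aHi = 1`; inner radii below outer ones;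
the label-locality dial inequalities of ZZZQ; `0 < g₀`).  In-tube cores: (X1ᴸ) between the members `y` (critical, derivative `0` by uniqueness) and
`xf`.  Off-tube cores: (OGᴸ)'s gap dominates `κ·Σ dist(xf i, y i)² ≤ (g₀/M)·n·(2ρ + 2q + ε + dB₁)² ≤ g₀` by `dist_label_le_of_core` and
`card_core_le`. [this file, g85] -/
theorem labelTubeCoercivityP_of_dichotomy {ϑc ϑ ϑp r rΘ q rsh ρ rm σ ϑr Rs ε rI ℓ ϑ₀ Rg sb dI dB sb₁ dI₁ dB₁ lam g₀ Λ θ s : ℝ}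
    (hg₀ : 0 < g₀) (hsb : sb₁ ≤ sb) (hdI : dI₁ ≤ dI) (hdB : dB₁ ≤ dB) (hdB₀ : 0 ≤ dB₁)
    (hε₀ : 0 ≤ ε) (hσε : 2 * ε < σ) (hcoolI : rΘ + ε < rI) (hrIρ : rI ≤ ρ + ε) (hρℓ : ρ < ℓ) (hρq : 0 ≤ ρ + q)
    (hrIℓ : rI + 28 / 25 + ε < ℓ) (hzone : rΘ + 2 * q + 2 * (28 / 25) + 2 * ε < ℓ)
    (hR : LabelTubeReferenceP ϑc ϑ ϑp r rΘ q rsh ρ rm σ ϑr Rs ε rI ℓ ϑ₀ Rg sb dI dB 1 Λ θ s)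
    (hX1 : LabelTubeConvexityP ϑc ϑ ϑp r rΘ q rsh ρ rm σ ϑr Rs ε rI ℓ ϑ₀ Rg sb dI dB lam 1 Λ θ s)
    (hOG : OffTubeGapP ϑc ϑ ϑp r rΘ q rsh ρ rm σ ϑr Rs ε rI ℓ Rg sb dI dB sb₁ dI₁ dB₁ g₀ 1 Λ θ s) :
    LabelTubeCoercivityP ϑc ϑ ϑp r rΘ q rsh ρ rm σ ϑr Rs ε rI ℓ Rg sb₁ dI₁ dB₁ (min lam (g₀ / gapModulusConst ρ q ε dB₁)) 1 Λ θ s := by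
  intro δ hδ a ha S hS hsum hgood L w hLw x₀ K hKS hKq hmild hcool n xf hxf hrange L' w' U t hCr lab hlab y hyT hyinj hydisj hcrit htame
  set X := S \ coreOf S K ρ with hX
  set y₀ : Fin n → E3 := fun i => lab (xf i) with hy₀
  have hsum0 : 0 ≤ ∑ i, dist (xf i) (y i) ^ 2 := Finset.sum_nonneg fun i _ => by positivity
  by_cases hin : xf ∈ bondTube X Rg sb dI dB y₀
  · -- SPECIAL SIDE: first-order strong convexity (X1ᴸ) between the tube members `y` and `xf`
    have href := hR δ hδ a ha S hS hsum hgood L w hLw x₀ K hKS hKq hmild hcool n xf hxf hrange L' w' U t hCr lab hlab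
    have hyO : y ∈ bondTube X Rg sb dI dB y₀ := bondTube_mono hsb hdI hdB hyT
    obtain ⟨φ, hφ, hconv⟩ :=
      hX1 δ hδ a ha S hS hsum hgood L w hLw x₀ K hKS hKq hmild hcool n xf hxf hrange L' w' U t hCr lab hlab href y hyO
    have hφ0 : φ = 0 := hφ.unique hcrit
    have key := hconv xf hin
    rw [hφ0, zero_apply, add_zero] at key
    have hdc : ∑ i, dist (y i) (xf i) ^ 2 = ∑ i, dist (xf i) (y i) ^ 2 := Finset.sum_congr rfl fun i _ => by rw [dist_comm]
    rw [hdc] at key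
    have hmin : min lam (g₀ / gapModulusConst ρ q ε dB₁) ≤ lam := min_le_left _ _
    nlinarith [mul_le_mul_of_nonneg_right hmin hsum0]
  · -- GENERIC SIDE: the off-tube gap dominates the modulus term
    have hgap := hOG δ hδ a ha S hS hsum hgood L w hLw x₀ K hKS hKq hmild hcool n xf hxf hrange L' w' U t hCr lab hlab hin y hyT hyinj hydisj
      hcrit htame
    -- label displacement and packing count
    obtain ⟨hdet, hsepH, hsh, hout, hinn⟩ := hCr
    obtain ⟨Ψ, τS, hΨ, hsurjΨ⟩ := exists_globalChart_of_isCharted hS.2.2.2.2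
    have hclean : ∀ p ∈ S, IsTwoShellGoodSet (1 / 16) (9 / 10) 1 S p := fun p hp => isTwoShellGoodSet_of_isDoorSetP hS hp
    have hsepS : IsSep (27 / 32) S := isSep_of_isDoorSetP le_rfl hS
    have hsepC : IsSep σ (placedCrystal L' w' U t) := isSep_placedCrystal U t hsepH
    have hcore : ∀ i, xf i ∈ coreOf S K ρ := fun i => hrange ▸ Set.mem_range_self i
    have hDi : ∀ i, dist (xf i) (y i) ≤ 2 * ρ + 2 * q + ε + dB₁ := fun i => by
      have h1 := dist_label_le_of_core hΨ hsurjΨ hclean (by norm_num) hsepS hsepC hε₀ hσε hcoolI hKq hzone hrIℓ hinn hlab hρℓ hrIρ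
        (hcore i)
      have h2 : dist (y i) (lab (xf i)) ≤ dB₁ := hyT.2.2 i
      linarith [dist_triangle (xf i) (lab (xf i)) (y i), dist_comm (y i) (lab (xf i))]
    have hD₀ : 0 ≤ 2 * ρ + 2 * q + ε + dB₁ := by linarith
    have hsumle : ∑ i, dist (xf i) (y i) ^ 2 ≤ n * (2 * ρ + 2 * q + ε + dB₁) ^ 2 := by
      have h1 : ∀ i ∈ Finset.univ, dist (xf i) (y i) ^ 2 ≤ (2 * ρ + 2 * q + ε + dB₁) ^ 2 := fun i _ =>
        pow_le_pow_left₀ dist_nonneg (hDi i) 2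
      have h2 := Finset.sum_le_card_nsmul _ _ _ h1
      rw [Finset.card_univ, Fintype.card_fin, nsmul_eq_mul] at h2
      exact h2
    have hn := card_core_le (by norm_num : (0 : ℝ) < 27 / 32) hsepS hKq hρq hxf hrange
    -- the modulus term is at most `g₀`
    have hM : ∑ i, dist (xf i) (y i) ^ 2 ≤ gapModulusConst ρ q ε dB₁ := by
      unfold gapModulusConst
      have h3 : (n : ℝ) * (2 * ρ + 2 * q + ε + dB₁) ^ 2 ≤ (2 * (ρ + q) / (27 / 32) + 1) ^ 3 * (2 * ρ + 2 * q + ε + dB₁) ^ 2 :=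
        mul_le_mul_of_nonneg_right hn (by positivity)
      exact hsumle.trans h3
    by_cases hMpos : 0 < gapModulusConst ρ q ε dB₁
    · have hκ : min lam (g₀ / gapModulusConst ρ q ε dB₁) * ∑ i, dist (xf i) (y i) ^ 2 ≤ g₀ := by
        calc min lam (g₀ / gapModulusConst ρ q ε dB₁) * ∑ i, dist (xf i) (y i) ^ 2
            ≤ (g₀ / gapModulusConst ρ q ε dB₁) * ∑ i, dist (xf i) (y i) ^ 2 :=
              mul_le_mul_of_nonneg_right (min_le_right _ _) hsum0
          _ ≤ (g₀ / gapModulusConst ρ q ε dB₁) * gapModulusConst ρ q ε dB₁ :=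
              mul_le_mul_of_nonneg_left hM (div_nonneg hg₀.le hMpos.le)
          _ = g₀ := div_mul_cancel₀ g₀ hMpos.ne'
      linarith
    · -- degenerate constant (`M ≤ 0` forces the sum to vanish)
      push Not at hMpos
      have hs0 : ∑ i, dist (xf i) (y i) ^ 2 = 0 := le_antisymm (hM.trans hMpos) hsum0
      rw [hs0, mul_zero, add_zero]
      linarith

/-- ★★ **CONVERSELY (PROVED): (QCᴸ⁺)(κ) ⟹ (OGᴸ)(g₀ := κ·min(((sb − sb₁)/2)², (dI − dI₁)², (dB − dB₁)²))** for `0 ≤ κ`, inner radii strictly below the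
outer ones — so (OGᴸ) is WEAKER than (QCᴸ⁺): off the outer tube one of the three clauses fails at some site/pair, and the inner-tube filling `y` is
then `≥` the corresponding margin away from `xf` there. [this file, g85] -/
theorem offTubeGapP_of_labelTubeCoercivity {ϑc ϑ ϑp r rΘ q rsh ρ rm σ ϑr Rs ε rI ℓ Rg sb dI dB sb₁ dI₁ dB₁ κ aHi Λ θ s : ℝ}
    (hκ : 0 ≤ κ) (hsb : sb₁ < sb) (hdI : dI₁ < dI) (hdB : dB₁ < dB)
    (h : LabelTubeCoercivityP ϑc ϑ ϑp r rΘ q rsh ρ rm σ ϑr Rs ε rI ℓ Rg sb₁ dI₁ dB₁ κ aHi Λ θ s) :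
    OffTubeGapP ϑc ϑ ϑp r rΘ q rsh ρ rm σ ϑr Rs ε rI ℓ Rg sb dI dB sb₁ dI₁ dB₁
      (κ * min (((sb - sb₁) / 2) ^ 2) (min ((dI - dI₁) ^ 2) ((dB - dB₁) ^ 2))) aHi Λ θ s := by
  intro δ hδ a ha S hS hsum hgood L w hLw x₀ K hKS hKq hmild hcool n xf hxf hrange L' w' U t hCr lab hlab hoff y hyT hyinj hydisj hcrit htame
  have key := h δ hδ a ha S hS hsum hgood L w hLw x₀ K hKS hKq hmild hcool n xf hxf hrange L' w' U t hCr lab hlab y hyT hyinj hydisj hcrit htame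
  set m : ℝ := min (((sb - sb₁) / 2) ^ 2) (min ((dI - dI₁) ^ 2) ((dB - dB₁) ^ 2)) with hm
  -- some site is at least the relevant margin away from the filling
  have hsingle : ∀ i, dist (xf i) (y i) ^ 2 ≤ ∑ j, dist (xf j) (y j) ^ 2 := fun i =>
    Finset.single_le_sum (f := fun j => dist (xf j) (y j) ^ 2) (fun j _ => by positivity) (Finset.mem_univ i)
  have hfar : m ≤ ∑ j, dist (xf j) (y j) ^ 2 := by
    by_contra hlt
    push Not at hlt
    apply hoff
    have hsite : ∀ i, dist (xf i) (y i) ^ 2 < m := fun i => lt_of_le_of_lt (hsingle i) hlt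
    refine ⟨fun i j hij => ?_, fun i hi => ?_, fun i => ?_⟩
    · -- bond clause
      have hyb : dist (y i - y j) (lab (xf i) - lab (xf j)) ≤ sb₁ := hyT.1 i j hij
      have h1 : dist (xf i - xf j) (y i - y j) ≤ dist (xf i) (y i) + dist (xf j) (y j) := by
        rw [dist_eq_norm, dist_eq_norm, dist_eq_norm]
        have : xf i - xf j - (y i - y j) = (xf i - y i) - (xf j - y j) := by abel
        rw [this]; exact norm_sub_le _ _
      have hi2 : dist (xf i) (y i) < (sb - sb₁) / 2 := by
        have := (hsite i).trans_le (min_le_left _ _)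
        exact lt_of_pow_lt_pow_left₀ 2 (by linarith) this
      have hj2 : dist (xf j) (y j) < (sb - sb₁) / 2 := by
        have := (hsite j).trans_le (min_le_left _ _)
        exact lt_of_pow_lt_pow_left₀ 2 (by linarith) this
      linarith [dist_triangle (xf i - xf j) (y i - y j) (lab (xf i) - lab (xf j))]
    · -- interstitial clause
      have hyi : dist (y i) (lab (xf i)) ≤ dI₁ := hyT.2.1 i hi
      have hi2 : dist (xf i) (y i) < dI - dI₁ := by
        have := (hsite i).trans_le ((min_le_right _ _).trans (min_le_left _ _))
        exact lt_of_pow_lt_pow_left₀ 2 (by linarith) this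
      linarith [dist_triangle (xf i) (y i) (lab (xf i))]
    · -- site clause
      have hyi : dist (y i) (lab (xf i)) ≤ dB₁ := hyT.2.2 i
      have hi2 : dist (xf i) (y i) < dB - dB₁ := by
        have := (hsite i).trans_le ((min_le_right _ _).trans (min_le_right _ _))
        exact lt_of_pow_lt_pow_left₀ 2 (by linarith) this
      linarith [dist_triangle (xf i) (y i) (lab (xf i))]
  nlinarith [mul_le_mul_of_nonneg_left hfar hκ]

end Dichotomy

end Summit.AtomisticToContinuum.Crystallization.Theorems.ChartedZeroExcessLayeredLatticeLiouville

end
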